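import Literature.MathematicalPhysics.QuantumFieldTheory.Dimock2011to13.QED3SingularWalkBound
import HarnessLib

/-!
# Dimock, *Quantum electrodynamics on the 3-torus II*, §3.2 LEMMA 2 proof PARTS IV–V (178)–(191) and COROLLARY 1
# (192)–(193): THE BACKGROUND-FIELD PERTURBATION SERIES `S*_□(A) = S*_□(0)Σ_n(v_□S*_□(0))^n` for the soft-Dirichlet local
# inverses — the kernel bound (187) ⟹ (188) PROVED in the MULTISCALE member (blocks `Δ ⊂ δΩ^{(k)}_j(□)` of side
# `L^{−(k−j)}`, link factor `L^{k−j}`), the summed kernel PROVED to be the inverse of (160), (190) ∕ (191) and the scalar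
# steps of (182) ∕ (184) ∕ (193) PROVED; by-product: THEOREM 1 (134) with its link factors `L^{k−i_j}` (multiscale chain)

statement-level skeleton of published theorems with citation tags; proofs where landed; nothing here is a claim about the Yang–Mills mass gap

(Writer seat p11 = literature-prover-lit-balaban-p11-g22-0; YM LIT SWEEP item (c), Lean lane — zero weight for the
YM-INPRINT tokens of row C13.)

**Citation header (reproduction of PUBLISHED work).** J. Dimock, *Quantum electrodynamics on the 3-torus II. The RG
flow*, arXiv:math-ph/0407063v1 (2004) [Dimock2004QED3TorusII], §3.2 «fermions», LEMMA 2 (p.22) with its proof Parts IV–V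
(pp.27–29) and COROLLARY 1 (p.29); `p.NN Lnn` = PDF page ∕ line of the held text layer `paper:arxiv-math-ph_0407063`.
This file continues the tree's `QED3SingularWalkBound` (THEOREM 1 proof Part III, single-scale member) and uses its engine
`dimock195` and the tree's LEMMA 1 (130) (`QED3BlockPotentialSums.eq130` via `hconv_Z3`) BY NAME.

**What the paper prints (verbatim, text layer).**
* p.22 L32–45, LEMMA 2: *"Under the same hypotheses for each `D_i` block `□` there is an operator `S*_□(A) = S*_{k,□}(A)`
  such that for `x ∈ □̃` `((D_{e_k}(A) + m_k + Q_{k,Λ}(−A)ᵀbQ_{k,Λ}(A))S*_□(A)f)(x) = f(x)` (136) and for all `x, y ∈ □̃`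
  `|S*_□(A,x,y)| ≤ O(1)d′(x,y)^{−2}exp(−O(1)d_Λ(x,y))` (137)"*; p.25 L52–59, (160): *"`S*_□(A) = S_{Ω(□)}(A) =
  [D_{e_k}(A) + m_k + Q_{Ω(□)}(−A)ᵀbQ_{Ω(□)}(A)]^{−1}_{L^{−k}Ω_0(□)}` (160) if it exists."*
* p.27 L66–80, PART IV: *"We continue to consider `□ ∈ D_i` and now study `S*_□(A)` for `A ≠ 0`. At first suppose that
  instead of the bound on `∂A` we have for some `C` `|A| ≤ CL^{(k−i)∕2}p(e_i)` on `δΛ^{(k)}_i` (178) … Let `v_□(A,A′) =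
  [D_{e_k}(A) + m_k + Q_{Ω(□)}(−A)ᵀbQ_{Ω(□)}(A)] − [D_{e_k}(A′) + m_k + Q_{Ω(□)}(−A′)ᵀbQ_{Ω(□)}(A′)]` (179) Then `S*_□(A)`
  exists if the series `S*_□(A) = S*_□(0)(Σ_{n=0}^∞(v_□(A,0)S*_□(0))^n)` (180) converges."*
* p.28 L2–20, (181)–(182): *"`(v^D_□(A,0)S*_□(0))(x,y) = Σ_{x′}γ_{x,x′}L^k(e^{ie_kL^{−k}A(x,x′)} − 1)(S*_□(0))(x′,y)` (181)
  which is bounded by `|(v^D_□(A,0)S*_□(0))(x,y)| ≤ O(1)e_k sup|A| d′(x,y)^{−2}exp(−O(1)d_{Ω(□)}(x,y)) ≤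
  O(1)e_kCL^{(k−i)∕2}p(e_i)d′(x,y)^{−2}exp(−O(1)d_{Ω(□)}(x,y)) = O(1)CL^{k−i}e_ip(e_i)d′(x,y)^{−2}exp(−O(1)d_{Ω(□)}(x,y))`
  (182)"*; p.28 L36–37, (184): *"The contour has length bounded by one and so we have bound `|(exp(ie_jA_{L^{k−j}}(…)) − 1)|
  ≤ e_j sup|A_{L^{k−j}}| ≤ CL^{−(i−j)∕2}e_jp(e_i) ≤ O(1)Ce_ip(e_i)` (184)"*; p.28 L47–50, (186): *"Combining the two bounds
  we have for `x ∈ δΩ^{(k)}_j(□)` `|(v_□(A,0)S*_□(0))(x,y)| ≤ O(1)CL^{k−j}e_ip(e_i)d′(x,y)^{−2}exp(−O(1)d_{Ω(□)}(x,y))` (186)"*.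
* p.28 L51–83, (187)–(188): *"Now we can estimate the expansion. Dividing `δΩ^{(k)}_j(□)` into blocks `Δ` of size
  `L^{−(k−j)}` and hence `L^{−k}Ω_0(□)` into blocks of various sizes we have `S*_□(A,x,y) = Σ_{n=0}^∞Σ_{Δ_1,…,Δ_n}
  ∫_{Δ_1}dx_1…∫_{Δ_n}dx_n(S*_□(0,x,x_1)(v_□(A)S*_□(0))(x_1,x_2)⋯(v_□(A)S*_□(0))(x_n,y)` (187) We use our estimate (186)
  as well as (154) and (155) and find `|S*_□(A,x,y)| ≤ (Σ_{n=0}^∞(O(1)Ce_ip(e_i))^n)d′(x,y)^{−2}exp(−O(1)d_{Ω(□)}(x,y)) ≤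
  O(1)d′(x,y)^{−2}exp(−O(1)d_{Ω(□)}(x,y))` (188) Here we use that `e_i < e_k` is assumed sufficiently small."*
* p.29 L1–26, PART V: *"Instead of (180) we use `S*_□(A) = S*_□(Ā)(Σ_{n=0}^∞(v_□(A,Ā)S*_□(Ā))^n)` (189) where `Ā` is the
  average of `A` over `L^{−k}Ω_0(□)`. Now `Ā` is pure gauge and can be written `Ā = dλ`. and Since the propagator is gauge
  invariant we have `S*_□(Ā,x,y) = e^{−ie_kλ(x)}S*_□(0,x,y)e^{−ie_kλ(y)}` (190) which satisfies the same bound (176) as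
  `S*_□(0,x,y)`. Also `|A − Ā| ≤ 11r_1M_0L^{−(k−i)}sup|∂A| ≤ C′L^{(k−i)∕2}Cp(e_i)` (191) for a new constant `C′`. … One can
  then show that `v_□(A,Ā)S*_□(Ā)` satisfies the same bound (186) used in part IV. Thus we can repeat part IV with the same
  result."*
* p.29 L29–51, COROLLARY 1: *"Let `A` be real and satisfy `|∂A| ≤ CL^{3(k−i)∕2}p(e_i)` on `δΛ^{(k)}_i` and let `A′` be
  complex and satisfy `|A′| ≤ CL^{(k−i)∕2}p(e_i)` on `δΛ^{(k)}_i`. Then `S*_□(A + A′)` and `S_{k,Λ,ω}(A + A′)` and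
  `S_{k,Λ}(A + A′)` all exist, are analytic in `A′`, and satisfy the `A′ = 0` bounds (134),(135), (137), now with larger
  constants. Proof. … `S*_□(A + A′) = S*_□(A)(Σ_{n=0}^∞(v_□(A + A′,A)S*_□(A))^n)` (192) … Here we use also
  `|exp(ie_kL^{−k}A′)| ≤ exp(e_kL^{−k}(CL^{(k−i)∕2}p(e_i)) ≤ exp(Ce_ip(e_i)) ≤ 2` (193) Now repeat part IV of the lemma"*.
* p.24 L76 – p.25 L3, THEOREM 1 proof Part III, (153)–(154): the chain with the link factors `L^{k−i_j}` and
  *"`L^{k−i_j}∫_{Δ_j}d′(x_{j−1},x_j)^{−2}d′(x_j,x_{j+1})^{−2}dx_j ≤ O(d′(x_{j−1},x_{j+1})^{−2})` (154) Which follow from (130).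
  Here we use that `□̃_j` is contained in `δΛ_{i_j} ∪ δΛ_{i_j+1}`, hence so is `Δ_j` and hence it is either a `L^{−(k−i_j)}`
  or a `L^{−(k−i_j−1)}` block."*

**What is formalized (kernel-checked, zero `sorry`; Mathlib + the tree).**  The MEMBER: the region `L^{−k}Ω_0(□)` is an
abstract finite site type `X` with «integrals» `∫dx = Σ_x w` (`w = L^{−3k}`, p.21 L31–34); its partition into blocks of
various sizes is a label map `blk : X → B` with centres `ctr` and a SCALE FACTOR `lam : B → ℝ≥0` (the printed `L^{k−j}` of
(186) for a block in `δΩ^{(k)}_j(□)`; the `L^{k−i_j}` of (153)); `d ≥ 0` is an abstract symmetric distance with the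
triangle inequality (the paper's `d_{Ω(□)}`, resp. `d_Λ`) in which every site is within `r` of its block centre; the
singular weight `d′^{−2}` is an abstract `P ≥ 0`.  Kernels take values in a real normed algebra `E` (spinor matrices).
* §1 **`dimock134_multiscale`** — THEOREM 1 (134) ∕ the engine of (188) WITH THE LINK FACTORS: if `‖Ks 0(u,v)‖ ≤
  C₀P(u,v)e^{−cd(u,v)}` and `‖Ks (j+1)(u,v)‖ ≤ (C₁∕M₀)·lam(Δ_u)·P(u,v)e^{−cd(u,v)}` (the factor of the block CONTAINING the
  left variable `u` — in (153) `x_j ∈ Δ_j` carries `L^{k−i_j} ≤ L·lam(Δ_j)` by the quoted p.25 L1–3), the SCALED (154)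
  `lam(Δ)·Σ_{y∈Δ}wP(u,y)P(y,v) ≤ θP(u,v)` holds for every block and `Σ_{Δ′}e^{−(c∕2)d(Δ,Δ′)} ≤ K`, then
  `‖pathKernel w Ks n x y‖ ≤ C₀e^{3cr}(C₁θKe^{2cr}∕M₀)^n·P(x,y)e^{−(c∕2)d(x,y)}`.  Proof = the tree's two-profile engine
  `QED3SingularWalkBound.dimock195` BY NAME (first profile `P`, inner profile `lam(Δ_u)P(u,v)`).
* §2 **LEMMA 2 Part IV**: `seriesLinks`∕**`seriesTerm`** (the `n`-th term of (187) = `pathKernel` of `S*_□(0)` followed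
  by `n` kernels `V` of `v_□S*_□(0)`; `seriesTerm_zero`, `seriesTerm_succ`); **`norm_seriesTerm_le`** ((176) `‖S₀‖ ≤ C₀Pe^{−cd}`
  + (186) `‖V(u,v)‖ ≤ ε·lam(Δ_u)P(u,v)e^{−cd}` ⟹ `‖T_n(x,y)‖ ≤ C₀e^{3cr}(εθKe^{2cr})^nP(x,y)e^{−(c∕2)d(x,y)}`);
  **`dimock188_partialSums`** (for `εθKe^{2cr} ≤ 1∕2`: `Σ_{n<N}‖T_n(x,y)‖ ≤ 2C₀e^{3cr}P(x,y)e^{−(c∕2)d(x,y)}` uniformly in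
  `N` — «`e_i` sufficiently small» is this number); `summable_norm_seriesTerm`, `summable_seriesTerm` (complete `E`);
  **`dimock188`** (the same bound for `‖Σ'_nT_n(x,y)‖`); `corollary1_partialSums` (COROLLARY 1 (192): the same series
  around the base `S*_□(A)` with the perturbation kernel of `v_□S*_□(A)` — the identical engine, recorded at its locus).
* §3 **existence = inverse** (the algebra of (160) ∕ (180), cf. (139)–(141)): `kmat w A = (w·A(x,y))` is the matrix of the
  operator with kernel `A` under `∫ = Σw`, `kcomp` the composite kernel (`kmat_kcomp`: composition = matrix product;
  `kmat_sub`; `kmat_pathKernel_succ`, `kmat_pathKernel_const`, **`kmat_seriesTerm`**: `kmat(T_n) = S*_□(0)·(v_□S*_□(0))^n`);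
  **`kmat_opA_mul_partialSum`**: with `O₀`, `Oₐ` the kernels of the operators at `0` and at `A`, `kmat O₀·kmat S₀ = 1` and
  `V` = kernel of `(O₀ − Oₐ)S*_□(0)`: `Oₐ·Σ_{n<N}T_n = 1 − (kmat V)^N` (Mathlib `mul_neg_geom_sum`);
  **`kmat_opA_mul_tsum_eq_one`**: if every entry series is summable, `Oₐ·kmat(Σ'_nT_n) = 1` (limit of the previous line;
  `(kmat V)^N = O₀·T_N → 0` as the term of a convergent series); **`kmat_tsum_mul_opA_eq_one`**: two-sided for commutative
  `E` (one-sided inverses of square matrices are two-sided) — the summed kernel IS the inverse of (160) on the region.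
* §4 **the size of the perturbation**: **`norm_hop_sum_le`** — the shape of (181) ⟹ (182) and of (144) ⟹ (143): a
  nearest-neighbour hopping operator (`≤ m` neighbours, coefficients of norm `≤ τ`) applied to a kernel column bounded by a
  majorant `F` comparable across a hop (`F(x′) ≤ κF(x)`) gives `≤ mτκF(x)`; on `ℤ³`, **`dOne_le_two_mul_of_hop`** ∕
  **`dprime_rpow_neg_two_hop_le`** (*"`d′(x′,y) ≥ d′(x,y)∕2`"*: `d′(x′,y)^{−2} ≤ 4d′(x,y)^{−2}` for `|x − x′|∞ ≤ 1`).
* §5 **the scalar steps**: `runningCoupling` (`e_k = L^{−(N−k)∕2}e`, p.4 L1) and `runningCoupling_eq_rpow_mul`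
  (`e_j = L^{(j−i)∕2}e_i`); **`dimock182_factor`** (`L^k|e^{ie_kL^{−k}A} − 1| ≤ e_k|A| ≤ CL^{k−i}e_ip` from (178) and
  `e_k = L^{(k−i)∕2}e_i` — Mathlib `Real.norm_exp_I_mul_ofReal_sub_one_le`); **`dimock184_factor`** (`|e^{ie_ja} − 1| ≤ e_j𝒜`
  for a contour integral `|a| ≤ 𝒜`); `norm_cexp_I_mul_le` and **`dimock193`** (`|e^{iz}| ≤ e^{|z|} ≤ 2` for complex `z`,
  `|z| ≤ log 2`).
* §6 **Part V**: **`norm_conj_eq_norm`** ∕ **`dimock190_transfer`** ((190): conjugating a kernel entry by phases — elements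
  with one-sided inverses, all of norm `≤ 1` — does not change its norm, so `S*_□(Ā)` obeys (176)); **`dimock191`** with
  `norm_sub_average_le`, `norm_sub_le_of_steps(')`, **`norm_sub_le_box`** ((191): on a box `Π_ν[a_ν,b_ν] ⊂ ℤ^κ`, unit-step
  differences `≤ δ` give `‖f(x) − f(y)‖ ≤ δΣ_ν|x_ν − y_ν|` and `‖f(x) − avg_Sf‖ ≤ δΣ_ν(b_ν − a_ν)` for any nonempty family
  `S` of box points).
* §7 **the scaled (154) on `ℤ³`, DISCHARGED uniformly in the scale**: **`hconv_Z3_multiscale`**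
  (`(ηR)^{−1}Σ_{y∈U}η³d′(u,y)^{−2}d′(y,v)^{−2} ≤ 8C(2)d′(u,v)^{−2}` for `#U ≤ R³` — `hconv_Z3` × the scale factor; the
  product `lam·θ(Δ)` is scale-free) and **`dimock154_L`** (the paper's letters: spacing `L^{−k}`, `#U ≤ (L^j)³`, factor
  `L^{k−j}`; `C(2) = blockConst 2 = 289`).

**Readings ∕ located items (declared).**  (i) SIGN IN (180) ∕ (189) ∕ (192): with `v_□(A,A′)` as defined in (179),
`[…](A)·S*_□(0) = 1 + v_□(A,0)S*_□(0)`, so the inverse is `S*_□(0)Σ_n(−v_□(A,0)S*_□(0))^n = S*_□(0)Σ_n(v_□(0,A)S*_□(0))^n`;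
the printed series carries `v_□(A,0)` — a sign immaterial for (181)–(188), which bound `|v_□|`.  §3 is stated with the
kernel `V` of `v_□(0,A)S*_□(0) = (O₀ − Oₐ)S*_□(0)`, for which the printed formula holds literally; §2 is sign-blind.
(ii) MULTISCALE BY POSITION: the printed link factor `L^{k−j}` of (186) is indexed by the shell `δΩ^{(k)}_j(□) ∋ x`; here it
is `lam(blk x)`, the factor of the block containing the left variable — the same thing once `δΩ^{(k)}_j(□)` is divided into
blocks of side `L^{−(k−j)}` (p.28 L51–53); in (153) the factor `L^{k−i_j}` of link `j` is `≤ L·lam(Δ_j)` by p.25 L1–3, the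
extra `L` joining the `O(1)` (footnote 1 p.6: *"O(1) allows L dependence"*).  (iii) REGION = SITE TYPE: `X` is
`L^{−k}Ω_0(□)` itself, so «the inverse on `L^{−k}Ω_0(□)`» of (160) is the matrix inverse on `X`; spinor indices may be
absorbed into `X` (then `E = ℂ` and §3's two-sided statement applies) or kept in `E`.  (iv) (190) prints
`e^{−ie_kλ(x)}S*_□(0,x,y)e^{−ie_kλ(y)}`; gauge covariance (42) gives `e^{+ie_kλ(y)}` on the right — immaterial here, §6 only
uses that the two phases are norm-`≤ 1` elements with norm-`≤ 1` one-sided inverses.  (v) (191)'s constant: the paper's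
`11r_1M_0L^{−(k−i)}` is the side of `□^{(5)}`; `dimock191` carries the `ℓ¹`-diameter `Σ_ν(b_ν − a_ν)` of the box (for a
cube, `3 ×` side) with `δ` = one lattice step × `sup|∂A|` — the paper itself continues with *"a new constant `C′`"*.
(vi) «sufficiently small» in (188) ∕ (193) = the explicit numbers `εθKe^{2cr} ≤ 1∕2`, `Ce_ip(e_i) ≤ log 2`.

**HONEST SCOPE ∕ what is NOT claimed.**  Parts I–III of the proof of LEMMA 2 — the soft-Dirichlet regions `Ω(□)` of
(156)–(159), the identification (161), the free mixed inverses `[S^{(k)}_j]_Y` and their bounds (162)–(167) (quoted from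
[14] = BOS, JMP **32**), the free local parametrix (168)–(177) — are NOT formalized: the free kernel bound (176) and the
perturbation bound (186) enter §2 as HYPOTHESES in their printed shape (§4–§5 prove only the scalar and combinatorial steps
(181) ⟹ (182), (183) ⟹ (184), not the kernel formulas (181) ∕ (183) of the concrete operators `D_{e_k}(A)`,
`Q_Ω(−A)ᵀbQ_Ω(A)` themselves); *"One can then show that `v_□(A,Ā)S*_□(Ā)` satisfies the same bound (186)"* (Part V) and
the analyticity in `A′` of COROLLARY 1 are not touched; the pure-gauge representation `Ā = dλ` is not constructed (§6 takes
the conjugated form (190) as given).  THEOREM 1's Parts I–II and the multi-region geometry (122)–(127) remain as in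
`QED3SingularWalkBound` (not formalized); §1 supplies only the estimate with position-dependent link factors.  No
convergence of (132) itself.  NOT a statement about the ultraviolet problem in `d = 4`; NOT a claim about any Bałaban
paper; [14] enters only as the paper's citation.  Unit `lit-balaban-p11-g22`, HOME `run/shared/lean/pub/lit-balaban/`,
2026-08-22.
-/

noncomputable section

open Finset Real Filter

namespace Literature.MathematicalPhysics.QuantumFieldTheory.Dimock2011to13

namespace QED3TorusII

/-! ## §1 The multiscale chain: (153) with link factors `L^{k−i_j}` ⟹ (134); the engine of (187) ⟹ (188) -/

section Multiscale

variable {X B : Type*} [Fintype X] [Fintype B] [DecidableEq B]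
variable {E : Type*} [NormedRing E] [NormedAlgebra ℝ E]
variable {d P : X → X → ℝ} {blk : X → B} {ctr : B → X} {lam : B → ℝ} {w c r θ : ℝ}

/-- **THEOREM 1 (134) ∕ LEMMA 2 (188), the MULTISCALE chain bound.**  Sites `X` (the region, `∫dx = Σ_x w`), blocks the
fibres of `blk : X → B` with centres `ctr` and SCALE FACTORS `lam Δ ≥ 0` (the printed `L^{k−j}` for a block `Δ ⊂ δΩ^{(k)}_j`
of side `L^{−(k−j)}`, resp. `L^{k−i_j}` in (153)), a singular weight `P ≥ 0` with the SCALED block convolution bound (154)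
`lam(Δ)·Σ_{y∈Δ}w·P(u,y)P(y,v) ≤ θP(u,v)` for every block, a symmetric `d ≥ 0` with the triangle inequality, every site within
`r` of its block centre, and the one-point block sum `Σ_{Δ′}e^{−(c∕2)d(Δ,Δ′)} ≤ K`.  If the first link kernel obeys
`‖Ks 0(u,v)‖ ≤ C₀P(u,v)e^{−cd(u,v)}` ((137) ∕ (176)) and every later link obeys the POSITION-DEPENDENT bound
`‖Ks (j+1)(u,v)‖ ≤ (C₁∕M₀)·lam(Δ_u)·P(u,v)e^{−cd(u,v)}` ((143) with `L^{k−i_j}`, resp. (186) with `L^{k−j}` for `u ∈ δΩ^{(k)}_j`),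
then `‖pathKernel w Ks n x y‖ ≤ C₀e^{3cr}(C₁θKe^{2cr}∕M₀)^n·P(x,y)e^{−(c∕2)d(x,y)}` — the printed (134)
`O(1)(O(1)M₀^{−1})^{|ω|}d′(x,y)^{−2}exp(−O(1)d_Λ(x,y))`.  Proof: the tree's two-profile engine `dimock195` BY NAME with first
profile `P` and inner profile `lam(Δ_u)·P(u,v)` (the scale factor rides with the left variable of each later link, i.e. with
the variable integrated over its block — *"repeatedly use the estimate (154)"*).
[cite: Dimock2004QED3TorusII, §3.2 Thm 1 (134) p.22 L12–17 with proof Part III (153)–(155) p.24 L76 – p.25 L12; Lemma 2 proof Part IV (187)–(188) p.28 L51–83] -/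
theorem dimock134_multiscale (hw : 0 ≤ w) (hθ : 0 ≤ θ) (hc : 0 ≤ c) (hP0 : ∀ u v, 0 ≤ P u v)
    (hlam : ∀ b, 0 ≤ lam b)
    (hconv : ∀ (b : B) (u v : X),
      lam b * ∑ y ∈ univ.filter (fun u => blk u = b), w * (P u y * P y v) ≤ θ * P u v)
    (hd0 : ∀ u v, 0 ≤ d u v) (hsymm : ∀ u v, d u v = d v u) (htri : ∀ u v t, d u t ≤ d u v + d v t)
    (hrad : ∀ u, d u (ctr (blk u)) ≤ r) {K : ℝ}
    (hK : ∀ b : B, ∑ b', Real.exp (-(c / 2) * d (ctr b) (ctr b')) ≤ K)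
    {C₀ C₁ M₀ : ℝ} (hC₀ : 0 ≤ C₀) (hC₁ : 0 ≤ C₁) (hM₀ : 0 < M₀) (Ks : ℕ → X → X → E)
    (hK0 : ∀ u v, ‖Ks 0 u v‖ ≤ C₀ * (P u v * Real.exp (-(c * d u v))))
    (hKS : ∀ j u v, ‖Ks (j + 1) u v‖ ≤ C₁ / M₀ * (lam (blk u) * P u v * Real.exp (-(c * d u v))))
    (n : ℕ) (x y : X) :
    ‖pathKernel w Ks n x y‖ ≤ C₀ * Real.exp (3 * c * r) * (C₁ * θ * K * Real.exp (2 * c * r) / M₀) ^ n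
        * P x y * Real.exp (-(c / 2) * d x y) := by
  have hmem : ∀ b, ∀ y ∈ univ.filter (fun u => blk u = b), blk y = b :=
    fun b y hy => (mem_filter.1 hy).2
  refine dimock195 (P₀ := P) (P := fun u v => lam (blk u) * P u v) hw hθ hc ?_ hP0 ?_ ?_ hd0 hsymm htri
    hrad hK hC₀ hC₁ hM₀ Ks hK0 ?_ n x y
  · intro u v
    exact mul_nonneg (hlam _) (hP0 u v)
  · intro b u v
    calc ∑ y ∈ univ.filter (fun u => blk u = b), w * ((lam (blk u) * P u y) * (lam (blk y) * P y v))
        = lam (blk u) * (lam b * ∑ y ∈ univ.filter (fun u => blk u = b), w * (P u y * P y v)) := by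
          rw [mul_sum, mul_sum]
          refine sum_congr rfl fun y hy => ?_
          rw [hmem b y hy]; ring
      _ ≤ lam (blk u) * (θ * P u v) := mul_le_mul_of_nonneg_left (hconv b u v) (hlam _)
      _ = θ * (lam (blk u) * P u v) := by ring
  · intro b u v
    calc ∑ y ∈ univ.filter (fun u => blk u = b), w * (P u y * (lam (blk y) * P y v))
        = lam b * ∑ y ∈ univ.filter (fun u => blk u = b), w * (P u y * P y v) := by
          rw [mul_sum]
          refine sum_congr rfl fun y hy => ?_
          rw [hmem b y hy]; ring
      _ ≤ θ * P u v := hconv b u v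
  · intro j u v
    simpa only [mul_assoc] using hKS j u v

end Multiscale

/-! ## §2 LEMMA 2 Part IV: the terms of the series (180) ∕ (187) and the bound (188) -/

section Series

variable {X : Type*} [Fintype X]
variable {E : Type*} [NormedRing E] [NormedAlgebra ℝ E]

/-- The link kernels of the `n`-th term of (180) ∕ (187): first `S*_□(0)`, then `n` copies of the kernel `V` of
`v_□S*_□(0)`. [cite: Dimock2004QED3TorusII, §3.2 Lemma 2 proof Part IV (180) p.27 L79 – p.28 L1 and (187) p.28 L51–70] -/
def seriesLinks (S₀ V : X → X → E) : ℕ → X → X → E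
  | 0 => S₀
  | _ + 1 => V

/-- **The `n`-th term of (187)**: `seriesTerm w S₀ V n x y = ∫dx_1⋯∫dx_n S*_□(0,x,x_1)(v_□S*_□(0))(x_1,x_2)⋯(v_□S*_□(0))(x_n,y)`
— the kernel of `S*_□(0)(v_□S*_□(0))^n`, as the tree's `pathKernel` of `seriesLinks`.
[cite: Dimock2004QED3TorusII, §3.2 Lemma 2 proof Part IV (187) p.28 L51–70] -/
def seriesTerm (w : ℝ) (S₀ V : X → X → E) (n : ℕ) : X → X → E := pathKernel w (seriesLinks S₀ V) n

/-- the zeroth term is `S*_□(0)` itself. [cite: Dimock2004QED3TorusII, §3.2 Lemma 2 proof Part IV (180) p.27 L79 – p.28 L1] -/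
theorem seriesTerm_zero (w : ℝ) (S₀ V : X → X → E) (x y : X) : seriesTerm w S₀ V 0 x y = S₀ x y := rfl

/-- peeling the first link: `T_{n+1}(x,y) = ∫dx_1 S*_□(0,x,x_1)·[the chain of n+1 kernels V](x_1,y)`.
[cite: Dimock2004QED3TorusII, §3.2 Lemma 2 proof Part IV (187) p.28 L51–70] -/
theorem seriesTerm_succ (w : ℝ) (S₀ V : X → X → E) (n : ℕ) (x y : X) :
    seriesTerm w S₀ V (n + 1) x y = ∑ x₁, w • (S₀ x x₁ * pathKernel w (fun _ => V) n x₁ y) := rfl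

variable {B : Type*} [Fintype B] [DecidableEq B]
variable {d P : X → X → ℝ} {blk : X → B} {ctr : B → X} {lam : B → ℝ} {w c r θ : ℝ}

/-- **(176) + (186) ⟹ the bound on the `n`-th term of (187).**  With `‖S*_□(0;u,v)‖ ≤ C₀P(u,v)e^{−cd_Ω(u,v)}` ((176)) and
`‖(v_□S*_□(0))(u,v)‖ ≤ ε·lam(Δ_u)·P(u,v)e^{−cd_Ω(u,v)}` ((186): `ε = O(1)Ce_ip(e_i)`, `lam(Δ_u) = L^{k−j}` for `u ∈ δΩ^{(k)}_j(□)`)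
and the multiscale hypotheses of `dimock134_multiscale`:
`‖T_n(x,y)‖ ≤ C₀e^{3cr}·(εθKe^{2cr})^n·P(x,y)e^{−(c∕2)d_Ω(x,y)}` — *"We use our estimate (186) as well as (154) and (155)"*.
[cite: Dimock2004QED3TorusII, §3.2 Lemma 2 proof Part IV (186)–(188) p.28 L47–83] -/
theorem norm_seriesTerm_le (hw : 0 ≤ w) (hθ : 0 ≤ θ) (hc : 0 ≤ c) (hP0 : ∀ u v, 0 ≤ P u v)
    (hlam : ∀ b, 0 ≤ lam b)
    (hconv : ∀ (b : B) (u v : X),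
      lam b * ∑ y ∈ univ.filter (fun u => blk u = b), w * (P u y * P y v) ≤ θ * P u v)
    (hd0 : ∀ u v, 0 ≤ d u v) (hsymm : ∀ u v, d u v = d v u) (htri : ∀ u v t, d u t ≤ d u v + d v t)
    (hrad : ∀ u, d u (ctr (blk u)) ≤ r) {K : ℝ}
    (hK : ∀ b : B, ∑ b', Real.exp (-(c / 2) * d (ctr b) (ctr b')) ≤ K)
    {C₀ ε : ℝ} (hC₀ : 0 ≤ C₀) (hε : 0 ≤ ε) (S₀ V : X → X → E)
    (hS₀ : ∀ u v, ‖S₀ u v‖ ≤ C₀ * (P u v * Real.exp (-(c * d u v))))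
    (hV : ∀ u v, ‖V u v‖ ≤ ε * (lam (blk u) * P u v * Real.exp (-(c * d u v))))
    (n : ℕ) (x y : X) :
    ‖seriesTerm w S₀ V n x y‖ ≤ C₀ * Real.exp (3 * c * r) * (ε * θ * K * Real.exp (2 * c * r)) ^ n
        * P x y * Real.exp (-(c / 2) * d x y) := by
  have hV' : ∀ (j : ℕ) (u v : X),
      ‖seriesLinks S₀ V (j + 1) u v‖ ≤ ε / 1 * (lam (blk u) * P u v * Real.exp (-(c * d u v))) :=
    fun j u v => by rw [div_one]; exact hV u v
  have h := dimock134_multiscale hw hθ hc hP0 hlam hconv hd0 hsymm htri hrad hK hC₀ hε one_pos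
    (seriesLinks S₀ V) (fun u v => hS₀ u v) hV' n x y
  rw [div_one] at h
  exact h

/-- **(188), every partial sum**: under the hypotheses of `norm_seriesTerm_le` and the smallness
`εθKe^{2cr} ≤ 1∕2` (*"Here we use that `e_i < e_k` is assumed sufficiently small"* — «sufficiently small» is this number),
`Σ_{n<N}‖T_n(x,y)‖ ≤ 2C₀e^{3cr}·P(x,y)e^{−(c∕2)d_Ω(x,y)}` uniformly in `N` — the printed
`|S*_□(A,x,y)| ≤ (Σ_n(O(1)Ce_ip(e_i))^n)d′(x,y)^{−2}exp(−O(1)d_{Ω(□)}(x,y)) ≤ O(1)d′(x,y)^{−2}exp(−O(1)d_{Ω(□)}(x,y))`.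
[cite: Dimock2004QED3TorusII, §3.2 Lemma 2 proof Part IV (188) p.28 L71–83] -/
theorem dimock188_partialSums (hw : 0 ≤ w) (hθ : 0 ≤ θ) (hc : 0 ≤ c) (hP0 : ∀ u v, 0 ≤ P u v)
    (hlam : ∀ b, 0 ≤ lam b)
    (hconv : ∀ (b : B) (u v : X),
      lam b * ∑ y ∈ univ.filter (fun u => blk u = b), w * (P u y * P y v) ≤ θ * P u v)
    (hd0 : ∀ u v, 0 ≤ d u v) (hsymm : ∀ u v, d u v = d v u) (htri : ∀ u v t, d u t ≤ d u v + d v t)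
    (hrad : ∀ u, d u (ctr (blk u)) ≤ r) {K : ℝ}
    (hK : ∀ b : B, ∑ b', Real.exp (-(c / 2) * d (ctr b) (ctr b')) ≤ K)
    {C₀ ε : ℝ} (hC₀ : 0 ≤ C₀) (hε : 0 ≤ ε) (S₀ V : X → X → E)
    (hS₀ : ∀ u v, ‖S₀ u v‖ ≤ C₀ * (P u v * Real.exp (-(c * d u v))))
    (hV : ∀ u v, ‖V u v‖ ≤ ε * (lam (blk u) * P u v * Real.exp (-(c * d u v))))
    (hsmall : ε * θ * K * Real.exp (2 * c * r) ≤ 1 / 2) (N : ℕ) (x y : X) :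
    ∑ n ∈ range N, ‖seriesTerm w S₀ V n x y‖
      ≤ 2 * (C₀ * Real.exp (3 * c * r)) * (P x y * Real.exp (-(c / 2) * d x y)) := by
  set q : ℝ := ε * θ * K * Real.exp (2 * c * r) with hq
  have hK0 : 0 ≤ K := (sum_nonneg fun b' _ => (Real.exp_pos _).le).trans (hK (blk x))
  have hq0 : 0 ≤ q := by positivity
  have hΦ : 0 ≤ C₀ * Real.exp (3 * c * r) * (P x y * Real.exp (-(c / 2) * d x y)) :=
    mul_nonneg (mul_nonneg hC₀ (Real.exp_pos _).le) (mul_nonneg (hP0 x y) (Real.exp_pos _).le)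
  calc ∑ n ∈ range N, ‖seriesTerm w S₀ V n x y‖
      ≤ ∑ n ∈ range N, C₀ * Real.exp (3 * c * r) * q ^ n * P x y * Real.exp (-(c / 2) * d x y) :=
        sum_le_sum fun n _ => norm_seriesTerm_le hw hθ hc hP0 hlam hconv hd0 hsymm htri hrad hK hC₀ hε S₀ V
          hS₀ hV n x y
    _ = C₀ * Real.exp (3 * c * r) * (P x y * Real.exp (-(c / 2) * d x y)) * ∑ n ∈ range N, q ^ n := by
        rw [mul_sum]; exact sum_congr rfl fun n _ => by ring
    _ ≤ C₀ * Real.exp (3 * c * r) * (P x y * Real.exp (-(c / 2) * d x y))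
          * ∑ n ∈ range N, (1 / 2 : ℝ) ^ n :=
        mul_le_mul_of_nonneg_left (sum_le_sum fun n _ => pow_le_pow_left₀ hq0 hsmall n) hΦ
    _ ≤ C₀ * Real.exp (3 * c * r) * (P x y * Real.exp (-(c / 2) * d x y)) * 2 :=
        mul_le_mul_of_nonneg_left (sum_geometric_two_le N) hΦ
    _ = 2 * (C₀ * Real.exp (3 * c * r)) * (P x y * Real.exp (-(c / 2) * d x y)) := by ring

/-- **The series (180) converges absolutely, entry by entry**: under the hypotheses of `dimock188_partialSums`,
`n ↦ ‖T_n(x,y)‖` is summable (comparison with the geometric series).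
[cite: Dimock2004QED3TorusII, §3.2 Lemma 2 proof Part IV (180), (188) p.27 L79 – p.28 L83] -/
theorem summable_norm_seriesTerm (hw : 0 ≤ w) (hθ : 0 ≤ θ) (hc : 0 ≤ c) (hP0 : ∀ u v, 0 ≤ P u v)
    (hlam : ∀ b, 0 ≤ lam b)
    (hconv : ∀ (b : B) (u v : X),
      lam b * ∑ y ∈ univ.filter (fun u => blk u = b), w * (P u y * P y v) ≤ θ * P u v)
    (hd0 : ∀ u v, 0 ≤ d u v) (hsymm : ∀ u v, d u v = d v u) (htri : ∀ u v t, d u t ≤ d u v + d v t)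
    (hrad : ∀ u, d u (ctr (blk u)) ≤ r) {K : ℝ}
    (hK : ∀ b : B, ∑ b', Real.exp (-(c / 2) * d (ctr b) (ctr b')) ≤ K)
    {C₀ ε : ℝ} (hC₀ : 0 ≤ C₀) (hε : 0 ≤ ε) (S₀ V : X → X → E)
    (hS₀ : ∀ u v, ‖S₀ u v‖ ≤ C₀ * (P u v * Real.exp (-(c * d u v))))
    (hV : ∀ u v, ‖V u v‖ ≤ ε * (lam (blk u) * P u v * Real.exp (-(c * d u v))))
    (hsmall : ε * θ * K * Real.exp (2 * c * r) ≤ 1 / 2) (x y : X) :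
    Summable fun n => ‖seriesTerm w S₀ V n x y‖ := by
  set q : ℝ := ε * θ * K * Real.exp (2 * c * r) with hq
  have hK0 : 0 ≤ K := (sum_nonneg fun b' _ => (Real.exp_pos _).le).trans (hK (blk x))
  have hq0 : 0 ≤ q := by positivity
  have hq1 : q < 1 := lt_of_le_of_lt hsmall (by norm_num)
  refine Summable.of_nonneg_of_le (fun n => norm_nonneg _) (fun n => ?_)
    ((summable_geometric_of_lt_one hq0 hq1).mul_left
      (C₀ * Real.exp (3 * c * r) * P x y * Real.exp (-(c / 2) * d x y)))
  have h := norm_seriesTerm_le hw hθ hc hP0 hlam hconv hd0 hsymm htri hrad hK hC₀ hε S₀ V hS₀ hV n x y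
  calc ‖seriesTerm w S₀ V n x y‖
      ≤ C₀ * Real.exp (3 * c * r) * q ^ n * P x y * Real.exp (-(c / 2) * d x y) := h
    _ = C₀ * Real.exp (3 * c * r) * P x y * Real.exp (-(c / 2) * d x y) * q ^ n := by ring

/-- … hence (complete coefficient algebra `E`, e.g. spinor matrices) `n ↦ T_n(x,y)` itself is summable: *"`S*_□(A)`
exists if the series … converges"*. [cite: Dimock2004QED3TorusII, §3.2 Lemma 2 proof Part IV (180), (188) p.27 L79 – p.28 L83] -/
theorem summable_seriesTerm [CompleteSpace E] (hw : 0 ≤ w) (hθ : 0 ≤ θ) (hc : 0 ≤ c)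
    (hP0 : ∀ u v, 0 ≤ P u v) (hlam : ∀ b, 0 ≤ lam b)
    (hconv : ∀ (b : B) (u v : X),
      lam b * ∑ y ∈ univ.filter (fun u => blk u = b), w * (P u y * P y v) ≤ θ * P u v)
    (hd0 : ∀ u v, 0 ≤ d u v) (hsymm : ∀ u v, d u v = d v u) (htri : ∀ u v t, d u t ≤ d u v + d v t)
    (hrad : ∀ u, d u (ctr (blk u)) ≤ r) {K : ℝ}
    (hK : ∀ b : B, ∑ b', Real.exp (-(c / 2) * d (ctr b) (ctr b')) ≤ K)
    {C₀ ε : ℝ} (hC₀ : 0 ≤ C₀) (hε : 0 ≤ ε) (S₀ V : X → X → E)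
    (hS₀ : ∀ u v, ‖S₀ u v‖ ≤ C₀ * (P u v * Real.exp (-(c * d u v))))
    (hV : ∀ u v, ‖V u v‖ ≤ ε * (lam (blk u) * P u v * Real.exp (-(c * d u v))))
    (hsmall : ε * θ * K * Real.exp (2 * c * r) ≤ 1 / 2) (x y : X) :
    Summable fun n => seriesTerm w S₀ V n x y :=
  (summable_norm_seriesTerm hw hθ hc hP0 hlam hconv hd0 hsymm htri hrad hK hC₀ hε S₀ V hS₀ hV
    hsmall x y).of_norm

/-- **(188) for the summed kernel** `S*_□(A;x,y) := Σ'_n T_n(x,y)`: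
`‖Σ'_n T_n(x,y)‖ ≤ 2C₀e^{3cr}·P(x,y)e^{−(c∕2)d_Ω(x,y)}` — *"`|S*_□(A,x,y)| ≤ O(1)d′(x,y)^{−2}exp(−O(1)d_{Ω(□)}(x,y))`"*.
[cite: Dimock2004QED3TorusII, §3.2 Lemma 2 proof Part IV (188) p.28 L71–83] -/
theorem dimock188 (hw : 0 ≤ w) (hθ : 0 ≤ θ) (hc : 0 ≤ c) (hP0 : ∀ u v, 0 ≤ P u v)
    (hlam : ∀ b, 0 ≤ lam b)
    (hconv : ∀ (b : B) (u v : X),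
      lam b * ∑ y ∈ univ.filter (fun u => blk u = b), w * (P u y * P y v) ≤ θ * P u v)
    (hd0 : ∀ u v, 0 ≤ d u v) (hsymm : ∀ u v, d u v = d v u) (htri : ∀ u v t, d u t ≤ d u v + d v t)
    (hrad : ∀ u, d u (ctr (blk u)) ≤ r) {K : ℝ}
    (hK : ∀ b : B, ∑ b', Real.exp (-(c / 2) * d (ctr b) (ctr b')) ≤ K)
    {C₀ ε : ℝ} (hC₀ : 0 ≤ C₀) (hε : 0 ≤ ε) (S₀ V : X → X → E)
    (hS₀ : ∀ u v, ‖S₀ u v‖ ≤ C₀ * (P u v * Real.exp (-(c * d u v))))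
    (hV : ∀ u v, ‖V u v‖ ≤ ε * (lam (blk u) * P u v * Real.exp (-(c * d u v))))
    (hsmall : ε * θ * K * Real.exp (2 * c * r) ≤ 1 / 2) (x y : X) :
    ‖∑' n, seriesTerm w S₀ V n x y‖
      ≤ 2 * (C₀ * Real.exp (3 * c * r)) * (P x y * Real.exp (-(c / 2) * d x y)) := by
  have hs := summable_norm_seriesTerm hw hθ hc hP0 hlam hconv hd0 hsymm htri hrad hK hC₀ hε S₀ V hS₀
    hV hsmall x y
  refine (norm_tsum_le_tsum_norm hs).trans ?_
  exact Real.tsum_le_of_sum_range_le (fun n => norm_nonneg _) fun N =>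
    dimock188_partialSums hw hθ hc hP0 hlam hconv hd0 hsymm htri hrad hK hC₀ hε S₀ V hS₀ hV hsmall N x y

/-- **COROLLARY 1 (192), the series around the base `S*_□(A)`** (real `A` with the `∂A` bound, complex perturbation
`A′` with `|A′| ≤ CL^{(k−i)∕2}p(e_i)`): *"We make the expansion `S*_□(A + A′) = S*_□(A)(Σ_n(v_□(A + A′,A)S*_□(A))^n)` (192)
… the bound on complex `A′` can be used to show that `v_□(A + A′,A)S*_□(A)` satisfies (186) … Now repeat part IV"* —
the identical engine: base kernel `S_A` with the (137)-shape bound (constant `C₀′`), perturbation kernel `W` with the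
(186)-shape bound (constant `ε′`, which by (193) carries the extra factor `|e^{ie_kL^{−k}A′}| ≤ 2` of `dimock193`), smallness
`ε′θKe^{2cr} ≤ 1∕2`; every partial sum of (192) is bounded by `2C₀′e^{3cr}P(x,y)e^{−(c∕2)d(x,y)}` — *"the `A′ = 0` bounds …
now with larger constants"*.  Analyticity in `A′` is NOT claimed. [cite: Dimock2004QED3TorusII, §3.2 Cor. 1 (192)–(193) p.29 L29–51] -/
theorem corollary1_partialSums (hw : 0 ≤ w) (hθ : 0 ≤ θ) (hc : 0 ≤ c) (hP0 : ∀ u v, 0 ≤ P u v)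
    (hlam : ∀ b, 0 ≤ lam b)
    (hconv : ∀ (b : B) (u v : X),
      lam b * ∑ y ∈ univ.filter (fun u => blk u = b), w * (P u y * P y v) ≤ θ * P u v)
    (hd0 : ∀ u v, 0 ≤ d u v) (hsymm : ∀ u v, d u v = d v u) (htri : ∀ u v t, d u t ≤ d u v + d v t)
    (hrad : ∀ u, d u (ctr (blk u)) ≤ r) {K : ℝ}
    (hK : ∀ b : B, ∑ b', Real.exp (-(c / 2) * d (ctr b) (ctr b')) ≤ K)
    {C₀' ε' : ℝ} (hC₀' : 0 ≤ C₀') (hε' : 0 ≤ ε') (S_A W : X → X → E)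
    (hS_A : ∀ u v, ‖S_A u v‖ ≤ C₀' * (P u v * Real.exp (-(c * d u v))))
    (hW : ∀ u v, ‖W u v‖ ≤ ε' * (lam (blk u) * P u v * Real.exp (-(c * d u v))))
    (hsmall : ε' * θ * K * Real.exp (2 * c * r) ≤ 1 / 2) (N : ℕ) (x y : X) :
    ∑ n ∈ range N, ‖seriesTerm w S_A W n x y‖
      ≤ 2 * (C₀' * Real.exp (3 * c * r)) * (P x y * Real.exp (-(c / 2) * d x y)) :=
  dimock188_partialSums hw hθ hc hP0 hlam hconv hd0 hsymm htri hrad hK hC₀' hε' S_A W hS_A hW hsmall N x y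

end Series

/-! ## §3 The summed series IS the inverse on the region: the algebra of (160) ∕ (180) -/

section Inverse

variable {X : Type*} [Fintype X] [DecidableEq X]
variable {E : Type*} [NormedRing E] [NormedAlgebra ℝ E]

/-- **Operators ↔ kernels under `∫dy = Σ_y w`.**  The operator with kernel `A` acts by `(Af)(x) = ∫A(x,y)f(y)dy =
Σ_y w·A(x,y)f(y)`, i.e. it IS the matrix `kmat w A = (w·A(x,y))_{x,y}`; composition of operators is the matrix product
(`kmat_kcomp`) and the identity operator has kernel `δ_{xy}∕w`, matrix `1`.
[cite: Dimock2004QED3TorusII, §1.2.4 p.6 L37–39 («the propagator `G_k` has a kernel `G_k(x,x′)` defined so that `(G_kf)(x) = ∫G_k(x,x′)f(x′)dx′` where again the integral means the weighted sum») and §3.1 p.21 L33–34 («As usual `∫dy[⋯] = Σ_yL^{−3k}[⋯]`»)] -/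
def kmat (w : ℝ) (A : X → X → E) : Matrix X X E := Matrix.of fun x y => w • A x y

/-- kernel of the composite operator: `(A∘B)(x,z) = ∫A(x,y)B(y,z)dy = Σ_y w·A(x,y)B(y,z)`.
[cite: Dimock2004QED3TorusII, §3.1 p.21 L33–34 and §3.2 (152) p.24 L59–75] -/
def kcomp (w : ℝ) (A A' : X → X → E) : X → X → E := fun x z => ∑ y, w • (A x y * A' y z)

omit [Fintype X] [DecidableEq X] in
/-- entries of `kmat`. [cite: Dimock2004QED3TorusII, §1.2.4 p.6 L37–39] -/
theorem kmat_apply (w : ℝ) (A : X → X → E) (x y : X) : kmat w A x y = w • A x y := rfl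

omit [DecidableEq X] in
/-- composition of kernels is the product of matrices. [cite: Dimock2004QED3TorusII, §3.2 (141)–(142) p.23 L18–32 (operator products written as iterated kernels)] -/
theorem kmat_kcomp (w : ℝ) (A A' : X → X → E) : kmat w (kcomp w A A') = kmat w A * kmat w A' := by
  ext x z
  simp only [kmat_apply, kcomp, Matrix.mul_apply, smul_sum, smul_smul, smul_mul_smul_comm]

omit [Fintype X] [DecidableEq X] in
/-- `kmat` is additive: the matrix of a difference of kernels (used for `v_□ = […](A) − […](A′)`, (179)).
[cite: Dimock2004QED3TorusII, §3.2 Lemma 2 proof Part IV (179) p.27 L75–78] -/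
theorem kmat_sub (w : ℝ) (A A' : X → X → E) : kmat w (A - A') = kmat w A - kmat w A' := by
  ext x z
  simp only [kmat_apply, Pi.sub_apply, Matrix.sub_apply, smul_sub]

omit [DecidableEq X] in
/-- the matrix of a `pathKernel` peels its first link as a matrix factor.
[cite: Dimock2004QED3TorusII, §3.2 (142) ∕ (152) p.23 L22–32, p.24 L59–75] -/
theorem kmat_pathKernel_succ (w : ℝ) (K : ℕ → X → X → E) (n : ℕ) :
    kmat w (pathKernel w K (n + 1)) = kmat w (K 0) * kmat w (pathKernel w (fun j => K (j + 1)) n) := by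
  ext x z
  simp only [kmat_apply, pathKernel, Matrix.mul_apply, smul_sum, smul_smul, smul_mul_smul_comm]

/-- a chain of `n+1` equal links is the `(n+1)`-st matrix power. [cite: Dimock2004QED3TorusII, §3.2 Lemma 2 proof Part IV (180) p.27 L79 – p.28 L1 («`(v_□(A,0)S*_□(0))^n`»)] -/
theorem kmat_pathKernel_const (w : ℝ) (V : X → X → E) :
    ∀ n : ℕ, kmat w (pathKernel w (fun _ => V) n) = kmat w V ^ (n + 1)
  | 0 => by rw [zero_add, pow_one]; rfl
  | n + 1 => by rw [kmat_pathKernel_succ, kmat_pathKernel_const w V n, pow_succ' (kmat w V) (n + 1)]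

/-- **the `n`-th term of (180) as an operator**: `kmat w (T_n) = S*_□(0)·(v_□S*_□(0))^n` (matrices).
[cite: Dimock2004QED3TorusII, §3.2 Lemma 2 proof Part IV (180) p.27 L79 – p.28 L1] -/
theorem kmat_seriesTerm (w : ℝ) (S₀ V : X → X → E) :
    ∀ n : ℕ, kmat w (seriesTerm w S₀ V n) = kmat w S₀ * kmat w V ^ n
  | 0 => by rw [pow_zero, mul_one]; rfl
  | n + 1 => by
      show kmat w (pathKernel w (seriesLinks S₀ V) (n + 1)) = _
      rw [kmat_pathKernel_succ]
      show kmat w S₀ * kmat w (pathKernel w (fun _ => V) n) = _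
      rw [kmat_pathKernel_const]

/-- **The resolvent identity behind (180), every partial sum.**  Let `O₀`, `Oₐ` be the kernels of the two operators
`[D_{e_k}(0) + m_k + Q_Ω(0)ᵀbQ_Ω(0)]` and `[D_{e_k}(A) + m_k + Q_Ω(−A)ᵀbQ_Ω(A)]` on the region, `S₀` the kernel of the
inverse of the first (`kmat O₀ · kmat S₀ = 1`, (160) at `A = 0` ∕ (174)), and `V` the kernel of `v_□(0,A)S*_□(0)` with
`v_□(0,A) = O₀ − Oₐ` ((179) with the arguments `(0,A)` — see the module docstring for the sign).  Then
`Oₐ·Σ_{n<N}T_n = 1 − (v_□(0,A)S*_□(0))^N`.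
[cite: Dimock2004QED3TorusII, §3.2 Lemma 2 proof Part IV (179)–(180) p.27 L75 – p.28 L1 (cf. Thm 1 proof Part I (139)–(141) p.23 L8–21)] -/
theorem kmat_opA_mul_partialSum (w : ℝ) (O₀ Oₐ S₀ : X → X → E) (h0 : kmat w O₀ * kmat w S₀ = 1) (N : ℕ) :
    kmat w Oₐ * ∑ n ∈ range N, kmat w (seriesTerm w S₀ (kcomp w (O₀ - Oₐ) S₀) n)
      = 1 - kmat w (kcomp w (O₀ - Oₐ) S₀) ^ N := by
  have hV : kmat w (kcomp w (O₀ - Oₐ) S₀) = 1 - kmat w Oₐ * kmat w S₀ := by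
    rw [kmat_kcomp, kmat_sub, sub_mul, h0]
  have h1 : kmat w Oₐ * kmat w S₀ = 1 - kmat w (kcomp w (O₀ - Oₐ) S₀) := by
    rw [hV, sub_sub_cancel]
  calc kmat w Oₐ * ∑ n ∈ range N, kmat w (seriesTerm w S₀ (kcomp w (O₀ - Oₐ) S₀) n)
      = kmat w Oₐ * ∑ n ∈ range N, kmat w S₀ * kmat w (kcomp w (O₀ - Oₐ) S₀) ^ n := by
        congr 1; exact sum_congr rfl fun n _ => kmat_seriesTerm w S₀ _ n
    _ = (kmat w Oₐ * kmat w S₀) * ∑ n ∈ range N, kmat w (kcomp w (O₀ - Oₐ) S₀) ^ n := by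
        rw [← mul_sum, mul_assoc]
    _ = (1 - kmat w (kcomp w (O₀ - Oₐ) S₀)) * ∑ n ∈ range N, kmat w (kcomp w (O₀ - Oₐ) S₀) ^ n := by
        rw [h1]
    _ = 1 - kmat w (kcomp w (O₀ - Oₐ) S₀) ^ N := mul_neg_geom_sum _ N

open _root_.Topology in
/-- **LEMMA 2 existence clause: «`S*_□(A)` exists if the series converges».**  If, in addition to the hypotheses of
`kmat_opA_mul_partialSum`, every entry series `Σ_nT_n(x,y)` is summable (e.g. by `summable_seriesTerm`), then the summed
kernel `S*_□(A;x,y) := Σ'_nT_n(x,y)` is a right inverse of `Oₐ` on the region: `kmat Oₐ · kmat S*_□(A) = 1`.  (The proof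
is the limit `N → ∞` in the previous identity; `(v_□S*_□(0))^N = O₀·T_N → 0` because the terms of a convergent series tend
to zero.) [cite: Dimock2004QED3TorusII, §3.2 Lemma 2 (136) p.22 L33–41, (160) p.25 L55–60, proof Part IV (180) p.27 L79 – p.28 L1] -/
theorem kmat_opA_mul_tsum_eq_one (w : ℝ) (O₀ Oₐ S₀ : X → X → E) (h0 : kmat w O₀ * kmat w S₀ = 1)
    (hsum : ∀ x y, Summable fun n => seriesTerm w S₀ (kcomp w (O₀ - Oₐ) S₀) n x y) :
    kmat w Oₐ * kmat w (fun x y => ∑' n, seriesTerm w S₀ (kcomp w (O₀ - Oₐ) S₀) n x y) = 1 := by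
  set V : X → X → E := kcomp w (O₀ - Oₐ) S₀ with hVdef
  set T : ℕ → Matrix X X E := fun n => kmat w (seriesTerm w S₀ V n) with hTdef
  set M : Matrix X X E := kmat w (fun x y => ∑' n, seriesTerm w S₀ V n x y) with hMdef
  have hT : HasSum T M :=
    Pi.hasSum.2 fun x => Pi.hasSum.2 fun y => by
      show HasSum (fun n => w • seriesTerm w S₀ V n x y) (w • ∑' n, seriesTerm w S₀ V n x y)
      exact (hsum x y).hasSum.const_smul w
  -- the partial sums `Oₐ·Σ_{n<N}T_n = 1 − (kmat V)^N` converge to `Oₐ·M`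
  have hlim1 : Tendsto (fun N => (1 : Matrix X X E) - kmat w V ^ N) atTop (𝓝 (kmat w Oₐ * M)) := by
    refine ((hT.mul_left (kmat w Oₐ)).tendsto_sum_nat).congr fun N => ?_
    rw [← mul_sum]
    exact kmat_opA_mul_partialSum w O₀ Oₐ S₀ h0 N
  -- `(kmat V)^N = O₀·T_N → 0`
  have hVN : Tendsto (fun N => kmat w V ^ N) atTop (𝓝 0) := by
    have h1 : Tendsto T atTop (𝓝 0) := hT.summable.tendsto_atTop_zero
    have h2 : Tendsto (fun N => kmat w O₀ * T N) atTop (𝓝 (kmat w O₀ * 0)) :=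
      ((continuous_const.mul continuous_id).tendsto 0).comp h1
    rw [mul_zero] at h2
    refine h2.congr fun N => ?_
    show kmat w O₀ * kmat w (seriesTerm w S₀ V N) = kmat w V ^ N
    rw [kmat_seriesTerm, ← mul_assoc, h0, one_mul]
  have hlim2 : Tendsto (fun N => (1 : Matrix X X E) - kmat w V ^ N) atTop (𝓝 (1 - 0)) :=
    tendsto_const_nhds.sub hVN
  rw [sub_zero] at hlim2
  exact tendsto_nhds_unique hlim1 hlim2

/-- **… and two-sided when the coefficient algebra is commutative** (e.g. `E = ℂ` with the spinor index absorbed into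
the site type): a one-sided inverse of a square matrix is two-sided, so `kmat S*_□(A) · kmat Oₐ = 1` as well — `S*_□(A)` IS
the inverse `[D_{e_k}(A) + m_k + Q_Ω(−A)ᵀbQ_Ω(A)]^{−1}_{L^{−k}Ω_0(□)}` of (160).
[cite: Dimock2004QED3TorusII, §3.2 Lemma 2 (160) p.25 L55–60] -/
theorem kmat_tsum_mul_opA_eq_one {E : Type*} [NormedCommRing E] [NormedAlgebra ℝ E] (w : ℝ)
    (O₀ Oₐ S₀ : X → X → E) (h0 : kmat w O₀ * kmat w S₀ = 1)
    (hsum : ∀ x y, Summable fun n => seriesTerm w S₀ (kcomp w (O₀ - Oₐ) S₀) n x y) :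
    kmat w (fun x y => ∑' n, seriesTerm w S₀ (kcomp w (O₀ - Oₐ) S₀) n x y) * kmat w Oₐ = 1 :=
  mul_eq_one_comm.1 (kmat_opA_mul_tsum_eq_one w O₀ Oₐ S₀ h0 hsum)

end Inverse

/-! ## §4 The size of the perturbation: nearest-neighbour hops against a decaying kernel ((144), (181)) -/

section Hopping

variable {X : Type*} [Fintype X]
variable {E : Type*} [NormedRing E]

/-- **A hopping operator applied to a kernel column** — the shape of (144) `(R^D_□S*_□)(x,y) = Σ_{x′}γ_{x,x′}L^k
e^{ie_kL^{−k}A(x,x′)}(h_□(x) − h_□(x′))S*_□(x′,y)` and of (181) `(v^D_□(A,0)S*_□(0))(x,y) = Σ_{x′}γ_{x,x′}L^k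
(e^{ie_kL^{−k}A(x,x′)} − 1)S*_□(0)(x′,y)` (*"the sum is over nearest neighbors x′ of x"*): if the hopping coefficients
`t(x,x′)` vanish off a neighbour set of `≤ m` sites and have norm `≤ τ`, the column obeys `‖S(x′)‖ ≤ F(x′)`, and the
majorant is comparable across a hop (`F(x′) ≤ κF(x)` for neighbours — for `F = d′^{−2}e^{−O(1)d}` this is
*"`d′(x′,y) ≥ d′(x,y)∕2` and `d_Λ(x′,y) ≥ d_Λ(x,y) − 1`"*, p.23 L68–69; on `ℤ³` see `dprime_rpow_neg_two_hop_le`), then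
`‖Σ_{x′}t(x,x′)S(x′)‖ ≤ mτκ·F(x)`.
[cite: Dimock2004QED3TorusII, §3.2 Thm 1 proof Part II (144)–(145) p.23 L60–69; Lemma 2 proof Part IV (181)–(182) p.28 L2–22] -/
theorem norm_hop_sum_le (nbr : X → Finset X) (t : X → X → E) (S : X → E) (F : X → ℝ) {m : ℕ} {τ κ : ℝ}
    (hτ0 : 0 ≤ τ) (hκF : ∀ x, 0 ≤ κ * F x)
    (hsupp : ∀ x x', x' ∉ nbr x → t x x' = 0) (hcard : ∀ x, (nbr x).card ≤ m)
    (hτ : ∀ x x', ‖t x x'‖ ≤ τ) (hS : ∀ x', ‖S x'‖ ≤ F x') (hcomp : ∀ x, ∀ x' ∈ nbr x, F x' ≤ κ * F x)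
    (x : X) : ‖∑ x', t x x' * S x'‖ ≤ m * τ * (κ * F x) := by
  have hsub : ∑ x' ∈ nbr x, t x x' * S x' = ∑ x', t x x' * S x' :=
    sum_subset (subset_univ _) fun x' _ hx' => by rw [hsupp x x' hx', zero_mul]
  rw [← hsub]
  calc ‖∑ x' ∈ nbr x, t x x' * S x'‖
      ≤ ∑ x' ∈ nbr x, ‖t x x' * S x'‖ := norm_sum_le _ _
    _ ≤ ∑ x' ∈ nbr x, τ * (κ * F x) := sum_le_sum fun x' hx' =>
        (norm_mul_le _ _).trans
          (mul_le_mul (hτ x x') ((hS x').trans (hcomp x x' hx')) (norm_nonneg _) hτ0)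
    _ = (nbr x).card * (τ * (κ * F x)) := by rw [sum_const, nsmul_eq_mul]
    _ ≤ m * (τ * (κ * F x)) :=
        mul_le_mul_of_nonneg_right (by exact_mod_cast hcard x) (mul_nonneg hτ0 (hκF x))
    _ = m * τ * (κ * F x) := by ring

end Hopping

section HopZ3

/-- **«`d′(x′,y) ≥ d′(x,y)∕2`» for a nearest neighbour `x′` of `x` on `ℤ³`** (lattice units: `|x − x′|∞ ≤ 1`):
`dOne(x − y) ≤ 2·dOne(x′ − y)` — from the triangle inequality (128) and `dOne(x − x′) = 1 ≤ dOne(x′ − y)`.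
[cite: Dimock2004QED3TorusII, §3.2 Thm 1 proof Part II p.23 L68–69] -/
theorem dOne_le_two_mul_of_hop (x x' y : Fin 3 → ℤ) (h : supN (x - x') ≤ 1) :
    dOne (x - y) ≤ 2 * dOne (x' - y) := by
  have h1 := dOne_sub_le x x' y
  have h2 : dOne (x - x') = 1 := by
    unfold dOne
    exact max_eq_left (by exact_mod_cast h)
  have h3 := one_le_dOne (x' - y)
  linarith

/-- … hence the singular weight grows by at most `4` across a hop: `d′(x′,y)^{−2} ≤ 4·d′(x,y)^{−2}` (spacing `η > 0`) —
the comparability constant `κ` of `norm_hop_sum_le` for `P = d′^{−2}`.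
[cite: Dimock2004QED3TorusII, §3.2 Thm 1 proof Part II p.23 L68–69] -/
theorem dprime_rpow_neg_two_hop_le {η : ℝ} (hη : 0 < η) (x x' y : Fin 3 → ℤ) (h : supN (x - x') ≤ 1) :
    dprime η x' y ^ (-(2 : ℝ)) ≤ 4 * dprime η x y ^ (-(2 : ℝ)) := by
  have hpos' : 0 < dprime η x' y := dprime_pos hη _ _
  have hpos : 0 < dprime η x y := dprime_pos hη _ _
  have hcmp : dprime η x y ≤ 2 * dprime η x' y := by
    unfold dprime
    have := dOne_le_two_mul_of_hop x x' y h
    nlinarith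
  rw [Real.rpow_neg hpos'.le, Real.rpow_neg hpos.le,
    show (2 : ℝ) = ((2 : ℕ) : ℝ) by norm_num, Real.rpow_natCast, Real.rpow_natCast]
  rw [show (4 : ℝ) * (dprime η x y ^ 2)⁻¹ = ((dprime η x y / 2) ^ 2)⁻¹ by field_simp; ring]
  apply inv_anti₀ (by positivity)
  have : dprime η x y / 2 ≤ dprime η x' y := by linarith
  exact pow_le_pow_left₀ (by positivity) this 2

end HopZ3

/-! ## §5 The scalar steps of (182), (184), (193): running couplings and phase factors -/

section Scalars

/-- **The running coupling** `e_k = L^{−(N−k)∕2}e` (p.4: *"Here `e_k = L^{−(N−k)∕2}e` is a running coupling constant"*).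
[cite: Dimock2004QED3TorusII, §1.1 p.4 L1] -/
def runningCoupling (L e : ℝ) (N k : ℕ) : ℝ := L ^ (-(((N : ℝ) - k) / 2)) * e

/-- the bookkeeping `e_j = L^{(j−i)∕2}e_i` between two scales (`L > 0`), used in (182) as `e_k·L^{(k−i)∕2} = L^{k−i}e_i`
and in (184) as `e_jL^{−(i−j)∕2} = L^{−(i−j)}e_i`. [cite: Dimock2004QED3TorusII, §3.2 Lemma 2 proof Part IV (182) p.28 L13–22 and (184) p.28 L33–36] -/
theorem runningCoupling_eq_rpow_mul {L : ℝ} (hL : 0 < L) (e : ℝ) (N i j : ℕ) :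
    runningCoupling L e N j = L ^ (((j : ℝ) - i) / 2) * runningCoupling L e N i := by
  unfold runningCoupling
  rw [← mul_assoc, ← Real.rpow_add hL]
  congr 2
  ring

/-- **The scalar step of (181) ⟹ (182)**: for a real bond variable `A` with `|A| ≤ CL^{(k−i)∕2}p` ((178), `p = p(e_i)`)
and `e_k = L^{(k−i)∕2}e_i`, the hopping factor `L^k(e^{ie_kL^{−k}A} − 1)` of `v^D_□(A,0)` has modulus
`≤ e_k|A| ≤ CL^{k−i}e_ip` — *"`O(1)e_k sup|A| … ≤ O(1)e_kCL^{(k−i)∕2}p(e_i) … = O(1)CL^{k−i}e_ip(e_i)`"* (the `O(1)`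
here is `1`; it multiplies the hop count and `γ`-matrix norms of `norm_hop_sum_le`).
[cite: Dimock2004QED3TorusII, §3.2 Lemma 2 proof Part IV (181)–(182) p.28 L2–22] -/
theorem dimock182_factor {L : ℝ} (hL : 0 < L) {k i : ℕ} (hik : i ≤ k) {eₖ eᵢ C p A : ℝ} (heᵢ : 0 ≤ eᵢ)
    (hek : eₖ = L ^ (((k : ℝ) - i) / 2) * eᵢ) (hA : |A| ≤ C * L ^ (((k : ℝ) - i) / 2) * p) :
    L ^ k * ‖Complex.exp (Complex.I * ↑(eₖ * (L ^ k)⁻¹ * A)) - 1‖ ≤ C * L ^ (k - i) * eᵢ * p := by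
  have h1 : ‖Complex.exp (Complex.I * ↑(eₖ * (L ^ k)⁻¹ * A)) - 1‖ ≤ |eₖ * (L ^ k)⁻¹ * A| := by
    have := Real.norm_exp_I_mul_ofReal_sub_one_le (x := eₖ * (L ^ k)⁻¹ * A)
    simpa only [Real.norm_eq_abs] using this
  have hLk : 0 < L ^ k := pow_pos hL k
  have hr : 0 ≤ L ^ (((k : ℝ) - i) / 2) := (Real.rpow_pos_of_pos hL _).le
  have heₖ0 : 0 ≤ eₖ := by rw [hek]; exact mul_nonneg hr heᵢ
  have hCp : 0 ≤ C * L ^ (((k : ℝ) - i) / 2) * p := (abs_nonneg A).trans hA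
  calc L ^ k * ‖Complex.exp (Complex.I * ↑(eₖ * (L ^ k)⁻¹ * A)) - 1‖
      ≤ L ^ k * |eₖ * (L ^ k)⁻¹ * A| := mul_le_mul_of_nonneg_left h1 hLk.le
    _ = eₖ * |A| := by
        rw [abs_mul, abs_mul, abs_of_nonneg heₖ0, abs_of_pos (inv_pos.2 hLk)]
        field_simp
    _ ≤ (L ^ (((k : ℝ) - i) / 2) * eᵢ) * (C * L ^ (((k : ℝ) - i) / 2) * p) := by
        rw [hek]
        exact mul_le_mul_of_nonneg_left hA (mul_nonneg hr heᵢ)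
    _ = C * (L ^ (((k : ℝ) - i) / 2) * L ^ (((k : ℝ) - i) / 2)) * eᵢ * p := by ring
    _ = C * L ^ (k - i) * eᵢ * p := by
        rw [← Real.rpow_add hL, add_halves, ← Nat.cast_sub hik, Real.rpow_natCast]

/-- **The scalar step of (183) ⟹ (184)**: the contour factor `e^{ie_ja} − 1` with `a` = the (real) contour integral of the
rescaled field, `|a| ≤ 𝒜` (*"The contour has length bounded by one"*: `𝒜 = sup|A_{L^{k−j}}|`), has modulus `≤ e_j𝒜`.
[cite: Dimock2004QED3TorusII, §3.2 Lemma 2 proof Part IV (183)–(184) p.28 L23–36] -/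
theorem dimock184_factor {eⱼ a 𝒜 : ℝ} (heⱼ : 0 ≤ eⱼ) (ha : |a| ≤ 𝒜) :
    ‖Complex.exp (Complex.I * ↑(eⱼ * a)) - 1‖ ≤ eⱼ * 𝒜 := by
  have h1 : ‖Complex.exp (Complex.I * ↑(eⱼ * a)) - 1‖ ≤ |eⱼ * a| := by
    have := Real.norm_exp_I_mul_ofReal_sub_one_le (x := eⱼ * a)
    simpa only [Real.norm_eq_abs] using this
  refine h1.trans ?_
  rw [abs_mul, abs_of_nonneg heⱼ]
  exact mul_le_mul_of_nonneg_left ha heⱼ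

/-- **The phase factor of a COMPLEX field, (193)**: `‖e^{iz}‖ ≤ e^{‖z‖}` for complex `z` (`= e_kL^{−k}A′(x,x′)`).
[cite: Dimock2004QED3TorusII, §3.2 Cor. 1 proof (193) p.29 L46–50] -/
theorem norm_cexp_I_mul_le (z : ℂ) : ‖Complex.exp (Complex.I * z)‖ ≤ Real.exp ‖z‖ := by
  rw [Complex.norm_exp]
  refine Real.exp_le_exp.2 ((Complex.re_le_norm _).trans ?_)
  rw [norm_mul, Complex.norm_I, one_mul]

/-- **(193)**: `|exp(ie_kL^{−k}A′)| ≤ exp(e_kL^{−k}·CL^{(k−i)∕2}p(e_i)) ≤ exp(Ce_ip(e_i)) ≤ 2` — the last step for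
`Ce_ip(e_i) ≤ log 2` («`e_k` sufficiently small»). [cite: Dimock2004QED3TorusII, §3.2 Cor. 1 proof (193) p.29 L46–50] -/
theorem dimock193 {z : ℂ} {t : ℝ} (hz : ‖z‖ ≤ t) (ht : t ≤ Real.log 2) : ‖Complex.exp (Complex.I * z)‖ ≤ 2 := by
  refine (norm_cexp_I_mul_le z).trans ?_
  calc Real.exp ‖z‖ ≤ Real.exp (Real.log 2) := Real.exp_le_exp.2 (hz.trans ht)
    _ = 2 := Real.exp_log (by norm_num)

end Scalars

/-! ## §6 Part V: (190) phase conjugation preserves kernel bounds; (191) the field against its average -/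

section PartV

variable {E : Type*} [NormedRing E]

/-- **(190): conjugation by phases does not change kernel norms.**  In a normed ring, if `u` has a left inverse `ū`
and `u′` a right inverse `ū′`, all four of norm `≤ 1` (the phases `e^{∓ie_kλ(x)}`, `e^{∓ie_kλ(y)}`), then
`‖u·a·u′‖ = ‖a‖` — so `S*_□(Ā;x,y) = e^{−ie_kλ(x)}S*_□(0;x,y)e^{ie_kλ(y)}` *"satisfies the same bound (176) as
`S*_□(0,x,y)`"*. [cite: Dimock2004QED3TorusII, §3.2 Lemma 2 proof Part V (190) p.29 L15–21] -/
theorem norm_conj_eq_norm (u ub u' ub' a : E) (hu : ‖u‖ ≤ 1) (hu' : ‖u'‖ ≤ 1) (hub : ‖ub‖ ≤ 1)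
    (hub' : ‖ub'‖ ≤ 1) (h1 : ub * u = 1) (h2 : u' * ub' = 1) : ‖u * a * u'‖ = ‖a‖ := by
  apply le_antisymm
  · calc ‖u * a * u'‖ ≤ ‖u * a‖ * ‖u'‖ := norm_mul_le _ _
      _ ≤ ‖u‖ * ‖a‖ * ‖u'‖ := mul_le_mul_of_nonneg_right (norm_mul_le _ _) (norm_nonneg _)
      _ ≤ 1 * ‖a‖ * 1 :=
          mul_le_mul (mul_le_mul_of_nonneg_right hu (norm_nonneg _)) hu' (norm_nonneg _)
            (mul_nonneg zero_le_one (norm_nonneg _))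
      _ = ‖a‖ := by ring
  · have e : a = ub * (u * a * u') * ub' := by
      calc a = (ub * u) * a * (u' * ub') := by rw [h1, h2, one_mul, mul_one]
        _ = ub * (u * a * u') * ub' := by simp only [mul_assoc]
    calc ‖a‖ = ‖ub * (u * a * u') * ub'‖ := by rw [← e]
      _ ≤ ‖ub * (u * a * u')‖ * ‖ub'‖ := norm_mul_le _ _
      _ ≤ ‖ub‖ * ‖u * a * u'‖ * ‖ub'‖ := mul_le_mul_of_nonneg_right (norm_mul_le _ _) (norm_nonneg _)
      _ ≤ 1 * ‖u * a * u'‖ * 1 :=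
          mul_le_mul (mul_le_mul_of_nonneg_right hub (norm_nonneg _)) hub' (norm_nonneg _)
            (mul_nonneg zero_le_one (norm_nonneg _))
      _ = ‖u * a * u'‖ := by ring

/-- **(190) ⟹ the base kernel of (189) obeys (176).**  If `S_Ā(x,y) = U(x)·S₀(x,y)·U′(y)` with phases as in
`norm_conj_eq_norm` at every site, every entrywise bound on `S₀` holds for `S_Ā`.
[cite: Dimock2004QED3TorusII, §3.2 Lemma 2 proof Part V (189)–(190) p.29 L3–21] -/
theorem dimock190_transfer {X : Type*} (S₀ S₁ : X → X → E) (U Ub U' Ub' : X → E)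
    (hU : ∀ x, ‖U x‖ ≤ 1) (hU' : ∀ x, ‖U' x‖ ≤ 1) (hUb : ∀ x, ‖Ub x‖ ≤ 1) (hUb' : ∀ x, ‖Ub' x‖ ≤ 1)
    (h1 : ∀ x, Ub x * U x = 1) (h2 : ∀ x, U' x * Ub' x = 1)
    (hS₁ : ∀ x y, S₁ x y = U x * S₀ x y * U' y) {F : X → X → ℝ} (hS₀ : ∀ x y, ‖S₀ x y‖ ≤ F x y)
    (x y : X) : ‖S₁ x y‖ ≤ F x y := by
  rw [hS₁, norm_conj_eq_norm (U x) (Ub x) (U' y) (Ub' y) (S₀ x y) (hU x) (hU' y) (hUb x) (hUb' y) (h1 x) (h2 y)]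
  exact hS₀ x y

end PartV

section Poincare

variable {ι : Type*} {E' : Type*} [SeminormedAddCommGroup E']

/-- **A field against its average, step 1**: on a finite set, `‖f(x) − avg_S f‖ ≤ max_{y∈S}‖f(x) − f(y)‖` — here: any
common bound `M` of the differences bounds the deviation from the average (`Ā` = *"the average of `A` over
`L^{−k}Ω_0(□)`"*). [cite: Dimock2004QED3TorusII, §3.2 Lemma 2 proof Part V (191) p.29 L15–23] -/
theorem norm_sub_average_le [NormedSpace ℝ E'] (S : Finset ι) (hS : S.Nonempty) (f : ι → E') (x : ι) {M : ℝ}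
    (h : ∀ y ∈ S, ‖f x - f y‖ ≤ M) : ‖f x - (S.card : ℝ)⁻¹ • ∑ y ∈ S, f y‖ ≤ M := by
  have hc0 : (0 : ℝ) < S.card := by exact_mod_cast hS.card_pos
  have hc : (S.card : ℝ) ≠ 0 := hc0.ne'
  have e : f x - (S.card : ℝ)⁻¹ • ∑ y ∈ S, f y = (S.card : ℝ)⁻¹ • ∑ y ∈ S, (f x - f y) := by
    rw [sum_sub_distrib, sum_const, smul_sub, ← Nat.cast_smul_eq_nsmul ℝ, smul_smul, inv_mul_cancel₀ hc,
      one_smul]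
  rw [e, norm_smul, Real.norm_of_nonneg (inv_nonneg.2 hc0.le)]
  calc (S.card : ℝ)⁻¹ * ‖∑ y ∈ S, (f x - f y)‖
      ≤ (S.card : ℝ)⁻¹ * ∑ y ∈ S, ‖f x - f y‖ :=
        mul_le_mul_of_nonneg_left (norm_sum_le _ _) (inv_nonneg.2 hc0.le)
    _ ≤ (S.card : ℝ)⁻¹ * ∑ y ∈ S, M := mul_le_mul_of_nonneg_left (sum_le_sum h) (inv_nonneg.2 hc0.le)
    _ = M := by rw [sum_const, nsmul_eq_mul]; field_simp

/-- **step 2, one lattice direction**: along a lattice line, steps of size `≤ δ` between consecutive points of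
`[a,b]` give `‖g(m+t) − g(m)‖ ≤ δt` (telescoping — `|A(x) − A(x′)| ≤ |x − x′|·sup|∂A|` in one direction).
[cite: Dimock2004QED3TorusII, §3.2 Lemma 2 proof Part V (191) p.29 L21–23] -/
theorem norm_sub_le_of_steps (g : ℤ → E') {a b : ℤ} {δ : ℝ}
    (hstep : ∀ m, a ≤ m → m < b → ‖g (m + 1) - g m‖ ≤ δ) {m : ℤ} (hm : a ≤ m) :
    ∀ t : ℕ, m + t ≤ b → ‖g (m + t) - g m‖ ≤ δ * t
  | 0, _ => by simp
  | t + 1, ht => by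
      have ht' : m + (t : ℤ) < b := by push_cast at ht; omega
      have ih := norm_sub_le_of_steps g hstep hm t ht'.le
      have hs := hstep (m + t) (by omega) ht'
      calc ‖g (m + ↑(t + 1)) - g m‖ = ‖(g (m + t + 1) - g (m + t)) + (g (m + t) - g m)‖ := by
            push_cast; rw [← add_assoc, sub_add_sub_cancel]
        _ ≤ ‖g (m + t + 1) - g (m + t)‖ + ‖g (m + t) - g m‖ := norm_add_le _ _
        _ ≤ δ + δ * t := add_le_add hs ih
        _ = δ * ↑(t + 1) := by push_cast; ring

/-- one direction, any two points of the interval: `‖g(m) − g(n)‖ ≤ δ|m − n|`.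
[cite: Dimock2004QED3TorusII, §3.2 Lemma 2 proof Part V (191) p.29 L21–23] -/
theorem norm_sub_le_of_steps' (g : ℤ → E') {a b : ℤ} {δ : ℝ}
    (hstep : ∀ m, a ≤ m → m < b → ‖g (m + 1) - g m‖ ≤ δ) {m n : ℤ} (hm : a ≤ m) (hmb : m ≤ b)
    (hn : a ≤ n) (hnb : n ≤ b) : ‖g m - g n‖ ≤ δ * |(m : ℝ) - n| := by
  rcases le_total m n with hmn | hnm
  · obtain ⟨t, rfl⟩ : ∃ t : ℕ, n = m + t :=
      ⟨(n - m).toNat, by rw [Int.toNat_of_nonneg (sub_nonneg.2 hmn)]; ring⟩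
    have h := norm_sub_le_of_steps g hstep hm t hnb
    rw [norm_sub_rev]
    refine h.trans (le_of_eq ?_)
    congr 1
    push_cast
    rw [show (m : ℝ) - (m + t) = -(t : ℝ) by ring, abs_neg, abs_of_nonneg (Nat.cast_nonneg t)]
  · obtain ⟨t, rfl⟩ : ∃ t : ℕ, m = n + t :=
      ⟨(m - n).toNat, by rw [Int.toNat_of_nonneg (sub_nonneg.2 hnm)]; ring⟩
    have h := norm_sub_le_of_steps g hstep hn t hmb
    refine h.trans (le_of_eq ?_)
    congr 1
    push_cast
    rw [show (n : ℝ) + t - n = (t : ℝ) by ring, abs_of_nonneg (Nat.cast_nonneg t)]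

/-- **step 3, a box**: if every unit step inside the box `Π_ν[a_ν,b_ν] ⊂ ℤ^κ` changes `f` by at most `δ` (`δ` = spacing ×
`sup|∂A|`), then for any two points of the box `‖f(x) − f(y)‖ ≤ δ·Σ_ν|x_ν − y_ν|` (change one coordinate at a time along
lattice lines inside the box). [cite: Dimock2004QED3TorusII, §3.2 Lemma 2 proof Part V (191) p.29 L21–23] -/
theorem norm_sub_le_box {κ : Type*} [Fintype κ] [DecidableEq κ] (f : (κ → ℤ) → E') (a b : κ → ℤ) {δ : ℝ}
    (hstep : ∀ z : κ → ℤ, (∀ i, a i ≤ z i ∧ z i ≤ b i) → ∀ ν, z ν < b ν →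
      ‖f (Function.update z ν (z ν + 1)) - f z‖ ≤ δ)
    (x y : κ → ℤ) (hx : ∀ i, a i ≤ x i ∧ x i ≤ b i) (hy : ∀ i, a i ≤ y i ∧ y i ≤ b i) :
    ‖f x - f y‖ ≤ δ * ∑ ν, |(x ν : ℝ) - y ν| := by
  suffices H : ∀ (s : Finset κ) (x : κ → ℤ), (∀ i, a i ≤ x i ∧ x i ≤ b i) → (∀ i ∉ s, x i = y i) →
      ‖f x - f y‖ ≤ δ * ∑ ν ∈ s, |(x ν : ℝ) - y ν| from
    H univ x hx fun i hi => absurd (mem_univ i) hi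
  intro s
  induction s using Finset.induction_on with
  | empty =>
      intro x hx hxy
      have : x = y := funext fun i => hxy i (by simp)
      simp [this]
  | insert ν s hν ih =>
      intro x hx hxy
      set x' : κ → ℤ := Function.update x ν (y ν) with hx'
      have hx'ν : x' ν = y ν := by simp [hx']
      have hx'ne : ∀ i, i ≠ ν → x' i = x i := fun i hi => by simp [hx', Function.update_of_ne hi]
      have hx'box : ∀ i, a i ≤ x' i ∧ x' i ≤ b i := by
        intro i
        by_cases hi : i = ν
        · rw [hi, hx'ν]; exact hy ν
        · rw [hx'ne i hi]; exact hx i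
      have hx'y : ∀ i ∉ s, x' i = y i := by
        intro i hi
        by_cases hiν : i = ν
        · rw [hiν, hx'ν]
        · rw [hx'ne i hiν]
          exact hxy i (by simp [hiν, hi])
      have h2 := ih x' hx'box hx'y
      have h1 : ‖f x - f x'‖ ≤ δ * |(x ν : ℝ) - y ν| := by
        have hline := norm_sub_le_of_steps' (fun t => f (Function.update x ν t)) (a := a ν) (b := b ν)
          (δ := δ) ?_ (hx ν).1 (hx ν).2 (hy ν).1 (hy ν).2
        · simpa only [Function.update_eq_self] using hline
        · intro t hat htb
          have hz : ∀ i, a i ≤ Function.update x ν t i ∧ Function.update x ν t i ≤ b i := by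
            intro i
            by_cases hi : i = ν
            · subst hi
              simp only [Function.update_self]
              exact ⟨hat, htb.le⟩
            · simp only [Function.update_of_ne hi]
              exact hx i
          have := hstep (Function.update x ν t) hz ν (by simpa only [Function.update_self] using htb)
          simpa only [Function.update_self, Function.update_idem] using this
      calc ‖f x - f y‖ = ‖(f x - f x') + (f x' - f y)‖ := by rw [sub_add_sub_cancel]
        _ ≤ ‖f x - f x'‖ + ‖f x' - f y‖ := norm_add_le _ _
        _ ≤ δ * |(x ν : ℝ) - y ν| + δ * ∑ μ ∈ s, |(x' μ : ℝ) - y μ| := add_le_add h1 h2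
        _ = δ * ∑ μ ∈ insert ν s, |(x μ : ℝ) - y μ| := by
            rw [sum_insert hν, mul_add]
            congr 2
            refine sum_congr rfl fun μ hμ => ?_
            have hμν : μ ≠ ν := fun h => hν (h ▸ hμ)
            rw [hx'ne μ hμν]

/-- **(191)**: for a field `A` on the sites of a box (one component `A_μ`, fixed `μ`) whose unit-step differences are
`≤ δ` (`δ = L^{−k}sup|∂A|`), the deviation from its average over any nonempty sub-family `S` of box points is
`≤ δ·Σ_ν(b_ν − a_ν)` — the printed `|A − Ā| ≤ 11r_1M_0L^{−(k−i)}sup|∂A|` with `11r_1M_0L^{−(k−i)}` = the side of `□^{(5)} ⊃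
L^{−k}Ω_0(□)`; here the constant is the `ℓ¹`-diameter `Σ_ν(b_ν − a_ν)` (= `3 ×` side for a cube; the paper continues
*"`≤ C′L^{(k−i)∕2}Cp(e_i)` for a new constant `C′`"*, so the numerical factor is immaterial).
[cite: Dimock2004QED3TorusII, §3.2 Lemma 2 proof Part V (191) p.29 L15–23] -/
theorem dimock191 [NormedSpace ℝ E'] {κ : Type*} [Fintype κ] [DecidableEq κ] (f : (κ → ℤ) → E') (a b : κ → ℤ) {δ : ℝ}
    (hδ : 0 ≤ δ)
    (hstep : ∀ z : κ → ℤ, (∀ i, a i ≤ z i ∧ z i ≤ b i) → ∀ ν, z ν < b ν →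
      ‖f (Function.update z ν (z ν + 1)) - f z‖ ≤ δ)
    (S : Finset (κ → ℤ)) (hS : S.Nonempty) (hSbox : ∀ y ∈ S, ∀ i, a i ≤ y i ∧ y i ≤ b i)
    (x : κ → ℤ) (hx : ∀ i, a i ≤ x i ∧ x i ≤ b i) :
    ‖f x - (S.card : ℝ)⁻¹ • ∑ y ∈ S, f y‖ ≤ δ * ∑ ν, ((b ν : ℝ) - a ν) := by
  refine norm_sub_average_le S hS f x fun y hy => ?_
  refine (norm_sub_le_box f a b hstep x y hx (hSbox y hy)).trans ?_
  refine mul_le_mul_of_nonneg_left (sum_le_sum fun ν _ => ?_) hδ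
  have h1 := hx ν
  have h2 := hSbox y hy ν
  rw [abs_le]
  constructor
  · have : ((a ν : ℤ) : ℝ) ≤ x ν := by exact_mod_cast h1.1
    have : ((y ν : ℤ) : ℝ) ≤ b ν := by exact_mod_cast h2.2
    linarith
  · have : ((x ν : ℤ) : ℝ) ≤ b ν := by exact_mod_cast h1.2
    have : ((a ν : ℤ) : ℝ) ≤ y ν := by exact_mod_cast h2.1
    linarith

end Poincare

/-! ## §7 The scaled (154) on the `ℤ³` lattice, uniformly in the scale -/

section Z3Multiscale

/-- **The SCALED (154) on the `ℤ³` lattice — DISCHARGED, uniformly in the scale.**  For sites at spacing `η > 0`, a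
block `U` of at most `R³` sites (`R ≥ 1`) and `d′ = η·max(1,|·|∞)`:
`(ηR)^{−1}·Σ_{y∈U}η³d′(u,y)^{−2}d′(y,v)^{−2} ≤ 8C(2)·d′(u,v)^{−2}` (`C(2) = blockConst 2 = 289`) — the tree's `hconv_Z3`
(LEMMA 1 (130) at `α = 2`, constant `2³C(2)(ηR)`) times the scale factor `lam = (ηR)^{−1}`: for `η = L^{−k}` and a block of
side `L^{−(k−j)}` (`R = L^j`), `lam = L^{k−j}` is exactly the printed link factor of (153) ∕ (186), and the product
`lam·θ(Δ) = 8C(2)` does not depend on `j` — the hypothesis `hconv` of `dimock134_multiscale` with ONE `θ` for blocks of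
all sizes. [cite: Dimock2004QED3TorusII, §3.2 Thm 1 proof Part III (154) p.24 L95 – p.25 L3 («`Δ_j` … is either a `L^{−(k−i_j)}` or a `L^{−(k−i_j−1)}` block») and §3.1 Lemma 1 (130) p.21 L40–42] -/
theorem hconv_Z3_multiscale {η : ℝ} (hη : 0 < η) {R : ℕ} (hR : 1 ≤ R) (U : Finset (Fin 3 → ℤ))
    (hcard : U.card ≤ R ^ 3) (u v : Fin 3 → ℤ) :
    (η * R)⁻¹ * ∑ y ∈ U, η ^ 3 * (dprime η u y ^ (-(2 : ℝ)) * dprime η y v ^ (-(2 : ℝ)))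
      ≤ 8 * blockConst 2 * dprime η u v ^ (-(2 : ℝ)) := by
  have h := hconv_Z3 hη hR U hcard u v
  have hR0 : (0 : ℝ) < R := by exact_mod_cast hR
  have hpos : 0 < η * R := mul_pos hη hR0
  have e8 : (2 : ℝ) ^ ((2 : ℝ) + 1) = 8 := by
    rw [show (2 : ℝ) + 1 = ((3 : ℕ) : ℝ) by norm_num, Real.rpow_natCast]; norm_num
  rw [show (3 : ℝ) - 2 = 1 by norm_num, Real.rpow_one, e8] at h
  calc (η * R)⁻¹ * ∑ y ∈ U, η ^ 3 * (dprime η u y ^ (-(2 : ℝ)) * dprime η y v ^ (-(2 : ℝ)))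
      ≤ (η * R)⁻¹ * (8 * blockConst 2 * (η * R) * dprime η u v ^ (-(2 : ℝ))) :=
        mul_le_mul_of_nonneg_left h (inv_nonneg.2 hpos.le)
    _ = 8 * blockConst 2 * dprime η u v ^ (-(2 : ℝ)) := by
        field_simp

/-- **… in the paper's letters**: spacing `L^{−k}`, a block of side `L^{−(k−j)}` (`#U ≤ (L^j)³`, `j ≤ k`, `L ≥ 1`), link
factor `L^{k−j}`: `L^{k−j}·∫_U d′(u,y)^{−2}d′(y,v)^{−2}dy ≤ 8C(2)·d′(u,v)^{−2}` — the printed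
`L^{k−i_j}∫_{Δ_j}d′(x_{j−1},x_j)^{−2}d′(x_j,x_{j+1})^{−2}dx_j ≤ O(d′(x_{j−1},x_{j+1})^{−2})` (154) with its `O` explicit and
uniform in the scale. [cite: Dimock2004QED3TorusII, §3.2 Thm 1 proof Part III (154) p.24 L95 – p.25 L3; Lemma 2 proof Part IV p.28 L51–53, L71] -/
theorem dimock154_L {L : ℕ} (hL : 1 ≤ L) {j k : ℕ} (hjk : j ≤ k) (U : Finset (Fin 3 → ℤ))
    (hcard : U.card ≤ (L ^ j) ^ 3) (u v : Fin 3 → ℤ) :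
    (L : ℝ) ^ (k - j) * ∑ y ∈ U, ((L : ℝ) ^ k)⁻¹ ^ 3 *
        (dprime ((L : ℝ) ^ k)⁻¹ u y ^ (-(2 : ℝ)) * dprime ((L : ℝ) ^ k)⁻¹ y v ^ (-(2 : ℝ)))
      ≤ 8 * blockConst 2 * dprime ((L : ℝ) ^ k)⁻¹ u v ^ (-(2 : ℝ)) := by
  have hL0 : (0 : ℝ) < L := by exact_mod_cast (show 0 < L by omega)
  have hη : 0 < ((L : ℝ) ^ k)⁻¹ := by positivity
  have hR : 1 ≤ L ^ j := Nat.one_le_pow _ _ (by omega)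
  have h := hconv_Z3_multiscale hη hR U hcard u v
  have e : (((L : ℝ) ^ k)⁻¹ * ((L ^ j : ℕ) : ℝ))⁻¹ = (L : ℝ) ^ (k - j) := by
    rw [spacing_mul_side hL hjk, inv_inv]
  rwa [e] at h

end Z3Multiscale

end QED3TorusII

end Literature.MathematicalPhysics.QuantumFieldTheory.Dimock2011to13
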